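import Summits.Ventures.HodgeRepro2.Tier7.Line3.TorusSupport

/-!
# The stabiliser of a regular double coset is the diagonal centre — `hmatch` reduces to (C) on the centre (support, seat p1)

x1's `Tier7/Line3/ConcreteLevelFactor.concrete_kappaData_b_fields` (p698828, l. 93) and `LevelFactorPositive` /
`LevelFactorOfLocal` display the CENTRAL MATCH on the stabiliser of the dominant representative `loc γ₀` as a hypothesis,
`hmatch : ∀ a b, (iotaA σ a)⁻¹ * loc γ₀ * iotaB σ f b = loc γ₀ → χA a * ψB b = 1` — in words: «for a regular `γ₀` the
stabiliser of the double coset is the diagonal centre, on which (C) gives the match» (the `[W]` column, M3 line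
l. 15764; t7-plan-3's assignment l. 15813 (1)). This file is that clause in the kernel, pure `2 × 2` linear algebra over a
field `F` with the involution's norm `nrm σ` (no measure, no topology, no continuity):

* `HasFullColumn M` («some column of `M` has no zero entry») and `Regular P γ := HasFullColumn (γ · P)` — REGULARITY as
  the displayed matrix hypothesis: the matrix of `γ` from the second basis `f` (the columns of the unit `P`) to the
  standard basis is NOT MONOMIAL; `not_monomial_iff` (every `M`) and `monomial_iff_of_isUnit` (for an invertible `M`,
  «monomial» = each column has exactly one non-zero entry and the two lie in different rows = diagonal · permutation);
* `regular_of_kappa` — the SAME predicate as the landed row 662 (`T7SupportTwoTorusInvariant.kappa`): for an isometry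
  `γ` of the hermitian form with orthogonal data, `κ(γ) ∉ {0, 1}` gives `Regular P γ` at the column `j = 0`
  (`κ = 0 ⟺ (γ f₀)₀ = 0` by the definition of `κ`; `κ = 1 ⟺ (γ f₀)₁ = 0` by row 662's `nrm_cc_one_zero`);
* **`central_of_stab`** — THE STABILISER LEMMA, for ANY `γ : GL (Fin 2) F`: if `Regular P γ` then every solution
  `(a, b) ∈ torusA σ × torusB σ f` of `(iotaA σ a)⁻¹ γ (iotaB σ f b) = γ` is CENTRAL — `∃ z`, `nrm σ z = 1`,
  `iotaA σ a = z • 1` and `iotaB σ f b = z • 1` as matrices (`γ t = D γ` ⇒ `D (γ f_j) = β_j (γ f_j)`: at a regular column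
  both diagonal entries of `D` equal `β_j`; the other column of the invertible `γ P` is non-zero, so its `β` is the same
  scalar; `t f_j = z f_j` on the basis `f` ⇒ `t P = z P` ⇒ `t = z • 1`);
* `scalarA σ z hz : torusA σ`, `scalarB σ f z hz : torusB σ f` — the scalar elements (`coe_iotaA_scalarA`,
  `coe_iotaB_scalarB`), and `iotaA_injective` / `iotaB_injective` (theorems of the read copies);
* **`hmatch_of_central`** — THE CONSUMER: `Regular P (loc γ₀)` and (C) ON THE CENTRE ALONE,
  `∀ z (hz : nrm σ z = 1), χA (scalarA σ z hz) * ψB (scalarB σ f z hz) = 1`, give x1's `hmatch` binder verbatim.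

So the `[W]`-column clause «(C) on the stabiliser for regular `γ₀`» becomes «(C) on the norm-one scalars» — the datum
condition that the central characters of `μ_{A,v₁}` and `μ_{B,v₁}⁻¹` agree (the dictionary, in words, unchanged:
`F = E_{v₁}`, `σ`, `f` / `P` the local second basis, `loc γ₀` the dominant representative, `χA = μ_{A,v₁}`,
`ψB = μ_{B,v₁}⁻¹`). Nothing here is about (N), (P), the real `X`, or HC_CM; §8(d): NO.
Blind lane: Mathlib + the HodgeRepro2 prefix; no sorry; axioms ⊆ {propext, Classical.choice, Quot.sound}.
-/

namespace Summit.Ventures.HodgeRepro2.T7SupportRegularStabilizer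

open Matrix Summit.Ventures.HodgeRepro2.T7SupportTwoTorusInvariant
  Summit.Ventures.HodgeRepro2.Tier7.Line3.TorusSupport

variable {F : Type*} [Field F] (σ : F →+* F)

/-! ## Regularity as a matrix hypothesis -/

/-- some column of `M` has no zero entry. -/
def HasFullColumn (M : Matrix (Fin 2) (Fin 2) F) : Prop := ∃ j, M 0 j ≠ 0 ∧ M 1 j ≠ 0

/-- `M` is monomial in the weak sense: every column has at most one non-zero entry. -/
def Monomial (M : Matrix (Fin 2) (Fin 2) F) : Prop := ∀ j, ∃ i, ∀ i', M i' j ≠ 0 → i' = i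

/-- **`γ` is REGULAR (with respect to the second basis `f` = the columns of `P`)**: some column of `γ · P` — the matrix of
`γ` from the basis `f` to the standard basis — has no zero entry, i.e. `γ · P` is not monomial. -/
def Regular (P γ : GL (Fin 2) F) : Prop :=
  HasFullColumn ((γ : Matrix (Fin 2) (Fin 2) F) * (P : Matrix (Fin 2) (Fin 2) F))

/-- **not monomial ⟺ some column has no zero entry** (every `2 × 2` matrix). -/
theorem not_monomial_iff (M : Matrix (Fin 2) (Fin 2) F) : ¬ Monomial M ↔ HasFullColumn M := by
  constructor
  · intro h
    obtain ⟨j, hj⟩ := not_forall.1 h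
    have hj' : ∀ i, ∃ i', M i' j ≠ 0 ∧ i' ≠ i := fun i => by
      obtain ⟨i', hi'⟩ := not_forall.1 (not_exists.1 hj i)
      exact ⟨i', Classical.not_imp.1 hi'⟩
    obtain ⟨i₁, hi₁, hi₁'⟩ := hj' 0
    obtain ⟨i₀, hi₀, hi₀'⟩ := hj' 1
    have e₁ : i₁ = 1 := by
      fin_cases i₁
      · exact absurd rfl hi₁'
      · rfl
    have e₀ : i₀ = 0 := by
      fin_cases i₀
      · rfl
      · exact absurd rfl hi₀'
    exact ⟨j, e₀ ▸ hi₀, e₁ ▸ hi₁⟩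
  · rintro ⟨j, h0, h1⟩ hM
    obtain ⟨i, hi⟩ := hM j
    have := (hi 0 h0).trans (hi 1 h1).symm
    exact absurd this (by decide)

/-- a `2 × 2` matrix with a zero column has zero determinant. -/
theorem det_eq_zero_of_col_zero (M : Matrix (Fin 2) (Fin 2) F) (j : Fin 2) (h : ∀ i, M i j = 0) : M.det = 0 :=
  Matrix.det_eq_zero_of_column_eq_zero j h

/-- **for an invertible matrix, «monomial» = diagonal · permutation**: each column has exactly one non-zero entry and the
two non-zero entries lie in different rows. -/
theorem monomial_iff_of_isUnit (M : Matrix (Fin 2) (Fin 2) F) (hM : IsUnit M.det) :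
    Monomial M ↔ ∃ i₀ i₁ : Fin 2, i₀ ≠ i₁ ∧ (∀ i, M i 0 ≠ 0 ↔ i = i₀) ∧ (∀ i, M i 1 ≠ 0 ↔ i = i₁) := by
  constructor
  · intro hm
    obtain ⟨i₀, h₀⟩ := hm 0
    obtain ⟨i₁, h₁⟩ := hm 1
    -- column 0 has a non-zero entry, necessarily at `i₀`
    have hne₀ : M i₀ 0 ≠ 0 := by
      intro hz
      apply hM.ne_zero
      apply det_eq_zero_of_col_zero M 0
      intro i
      by_contra hi
      exact absurd (h₀ i hi) (by rintro rfl; exact hi hz)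
    have hne₁ : M i₁ 1 ≠ 0 := by
      intro hz
      apply hM.ne_zero
      apply det_eq_zero_of_col_zero M 1
      intro i
      by_contra hi
      exact absurd (h₁ i hi) (by rintro rfl; exact hi hz)
    refine ⟨i₀, i₁, ?_, fun i => ⟨h₀ i, fun hi => hi ▸ hne₀⟩, fun i => ⟨h₁ i, fun hi => hi ▸ hne₁⟩⟩
    -- the two non-zero entries are in different rows: otherwise a zero row
    intro heq
    subst heq
    apply hM.ne_zero
    -- the other row `r ≠ i₀` is zero
    obtain ⟨r, hr⟩ : ∃ r : Fin 2, r ≠ i₀ := by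
      fin_cases i₀
      · exact ⟨1, by decide⟩
      · exact ⟨0, by decide⟩
    have hrow : ∀ j, M r j = 0 := by
      intro j
      by_contra hz
      fin_cases j
      · exact hr (h₀ r hz)
      · exact hr (h₁ r hz)
    exact Matrix.det_eq_zero_of_row_eq_zero r hrow
  · rintro ⟨i₀, i₁, _, h₀, h₁⟩ j
    fin_cases j
    · exact ⟨i₀, fun i hi => (h₀ i).1 hi⟩
    · exact ⟨i₁, fun i hi => (h₁ i).1 hi⟩

/-- the `(i, j)` entry of `γ · P` is the `i`-th coordinate of `γ f_j` when the columns of `P` are `f`. -/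
theorem mul_apply_eq_mulVec (γ P : Matrix (Fin 2) (Fin 2) F) (f : Fin 2 → Fin 2 → F)
    (hP : ∀ j, P.col j = f j) (i j : Fin 2) : (γ * P) i j = (γ *ᵥ f j) i := by
  rw [← hP j]
  simp [Matrix.mul_apply, Matrix.mulVec, dotProduct, Matrix.col]

/-- **regular in the sense of row 662** (`κ(γ) ∉ {0, 1}`, for an isometry `γ` of the hermitian form with orthogonal
data) **⇒ `Regular P γ`** at the column `j = 0`: `κ = 0 ⟺ (γ f₀)₀ = 0`, `κ = 1 ⟺ (γ f₀)₁ = 0`. -/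
theorem regular_of_kappa (d : Fin 2 → F) (hd : ∀ i, σ (d i) = d i) (hd0 : ∀ i, d i ≠ 0)
    (f : Fin 2 → Fin 2 → F) (hf0 : disc' σ d f 0 ≠ 0) (P γ : GL (Fin 2) F)
    (hP : ∀ j, (P : Matrix (Fin 2) (Fin 2) F).col j = f j)
    (hγ : IsIsom σ d (γ : Matrix (Fin 2) (Fin 2) F))
    (hκ0 : kappa σ d f (γ : Matrix (Fin 2) (Fin 2) F) ≠ 0)
    (hκ1 : kappa σ d f (γ : Matrix (Fin 2) (Fin 2) F) ≠ 1) : Regular P γ := by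
  refine ⟨0, ?_, ?_⟩
  · rw [mul_apply_eq_mulVec _ _ f hP]
    intro h
    apply hκ0
    unfold kappa cc
    rw [h, mul_zero]
    simp [nrm]
  · rw [mul_apply_eq_mulVec _ _ f hP]
    intro h
    apply hκ1
    have h1 := nrm_cc_one_zero σ d hd hd0 f hf0 (γ : Matrix (Fin 2) (Fin 2) F) hγ
    have h2 : cc d f (γ : Matrix (Fin 2) (Fin 2) F) 1 0 = 0 := by
      unfold cc
      rw [h, mul_zero]
    rw [h2] at h1
    simp only [nrm, zero_mul, map_zero] at h1
    have h3 : (1 - kappa σ d f (γ : Matrix (Fin 2) (Fin 2) F)) * (d 1 * disc' σ d f 0) = 0 := by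
      rw [← mul_assoc]; exact h1.symm
    rcases mul_eq_zero.1 h3 with h4 | h4
    · exact (sub_eq_zero.1 h4).symm
    · exact absurd h4 (mul_ne_zero (hd0 1) hf0)

/-! ## The stabiliser lemma -/

/-- the scalar matrix `z • 1` as an element of `GL (Fin 2) F`, for `z ≠ 0`. -/
def scalarUnit (z : F) (hz : z ≠ 0) : GL (Fin 2) F where
  val := z • (1 : Matrix (Fin 2) (Fin 2) F)
  inv := z⁻¹ • (1 : Matrix (Fin 2) (Fin 2) F)
  val_inv := by rw [Matrix.smul_mul, Matrix.mul_smul, smul_smul, one_mul, mul_inv_cancel₀ hz, one_smul]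
  inv_val := by rw [Matrix.smul_mul, Matrix.mul_smul, smul_smul, one_mul, inv_mul_cancel₀ hz, one_smul]

/-- the matrix of `scalarUnit z`. -/
theorem coe_scalarUnit (z : F) (hz : z ≠ 0) :
    ((scalarUnit z hz : GL (Fin 2) F) : Matrix (Fin 2) (Fin 2) F) = z • (1 : Matrix (Fin 2) (Fin 2) F) := rfl

/-- the scalar element of the first torus. -/
def scalarA (z : F) (hz : nrm σ z = 1) : torusA σ :=
  ⟨fun _ => Units.mk0 z (ne_zero_of_nrm_eq_one σ hz),
    (Subgroup.mem_pi Set.univ).2 fun _ _ => (mem_normOne σ _).2 (by rw [Units.val_mk0]; exact hz)⟩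

/-- the matrix of `iotaA σ (scalarA σ z hz)` is `z • 1`. -/
theorem coe_iotaA_scalarA (z : F) (hz : nrm σ z = 1) :
    ((iotaA σ (scalarA σ z hz) : GL (Fin 2) F) : Matrix (Fin 2) (Fin 2) F) = z • (1 : Matrix (Fin 2) (Fin 2) F) := by
  rw [coe_iotaA, Matrix.smul_one_eq_diagonal]
  rfl

variable (f : Fin 2 → Fin 2 → F)

/-- the scalar element of the second torus. -/
def scalarB (z : F) (hz : nrm σ z = 1) : torusB σ f :=
  ⟨scalarUnit z (ne_zero_of_nrm_eq_one σ hz),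
    (mem_torusB σ f _).2 ⟨fun _ => z, fun _ => hz, fun j => by
      rw [coe_scalarUnit, Matrix.smul_mulVec, Matrix.one_mulVec]⟩⟩

/-- the matrix of `iotaB σ f (scalarB σ f z hz)` is `z • 1`. -/
theorem coe_iotaB_scalarB (z : F) (hz : nrm σ z = 1) :
    ((iotaB σ f (scalarB σ f z hz) : GL (Fin 2) F) : Matrix (Fin 2) (Fin 2) F) =
      z • (1 : Matrix (Fin 2) (Fin 2) F) := rfl

/-- `iotaA σ` is injective (the diagonal entries recover the element). -/
theorem iotaA_injective : Function.Injective (iotaA σ) := by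
  intro a a' h
  have h1 := congrArg (fun g : GL (Fin 2) F => (g : Matrix (Fin 2) (Fin 2) F)) h
  simp only [coe_iotaA] at h1
  apply Subtype.ext
  funext i
  apply Units.ext
  have h2 := congrFun (congrFun h1 i) i
  simpa [Matrix.diagonal_apply_eq] using h2

/-- `iotaB σ f` is injective (it is the subtype map). -/
theorem iotaB_injective : Function.Injective (iotaB σ f) := Subtype.val_injective

/-- **THE STABILISER LEMMA**: for a regular `γ`, every `(a, b) ∈ torusA σ × torusB σ f` with
`(iotaA σ a)⁻¹ γ (iotaB σ f b) = γ` is central — both are the scalar `z • 1` for one norm-one `z`. -/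
theorem central_of_stab {P : GL (Fin 2) F} (hP : ∀ j, (P : Matrix (Fin 2) (Fin 2) F).col j = f j)
    {γ : GL (Fin 2) F} (hreg : Regular P γ) (a : torusA σ) (b : torusB σ f)
    (h : (iotaA σ a)⁻¹ * γ * iotaB σ f b = γ) :
    ∃ z : F, nrm σ z = 1 ∧
      ((iotaA σ a : GL (Fin 2) F) : Matrix (Fin 2) (Fin 2) F) = z • (1 : Matrix (Fin 2) (Fin 2) F) ∧
      ((iotaB σ f b : GL (Fin 2) F) : Matrix (Fin 2) (Fin 2) F) = z • (1 : Matrix (Fin 2) (Fin 2) F) := by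
  -- the equation in the group, then in the matrices: `D γ = γ t`
  have h1 : iotaA σ a * γ = γ * iotaB σ f b := by
    calc iotaA σ a * γ = iotaA σ a * ((iotaA σ a)⁻¹ * γ * iotaB σ f b) := by rw [h]
      _ = γ * iotaB σ f b := by group
  have h2 : ((iotaA σ a : GL (Fin 2) F) : Matrix (Fin 2) (Fin 2) F) * (γ : Matrix (Fin 2) (Fin 2) F) =
      (γ : Matrix (Fin 2) (Fin 2) F) * ((iotaB σ f b : GL (Fin 2) F) : Matrix (Fin 2) (Fin 2) F) := by
    have := congrArg Units.val h1
    simpa using this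
  -- the scalars by which `t` acts on the second basis
  obtain ⟨β, hβ, hact₀⟩ := (mem_torusB σ f _).1 b.2
  have hact : ActsOn f ((iotaB σ f b : GL (Fin 2) F) : Matrix (Fin 2) (Fin 2) F) β := hact₀
  -- `D (γ f_j) = β_j (γ f_j)` entrywise: `a_i (γ f_j)_i = β_j (γ f_j)_i`
  have key : ∀ i j, ((a : Fin 2 → Fˣ) i : F) * ((γ : Matrix (Fin 2) (Fin 2) F) *ᵥ f j) i =
      β j * ((γ : Matrix (Fin 2) (Fin 2) F) *ᵥ f j) i := by
    intro i j
    have e : ((iotaA σ a : GL (Fin 2) F) : Matrix (Fin 2) (Fin 2) F) *ᵥ ((γ : Matrix (Fin 2) (Fin 2) F) *ᵥ f j) =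
        β j • ((γ : Matrix (Fin 2) (Fin 2) F) *ᵥ f j) := by
      rw [Matrix.mulVec_mulVec, h2, ← Matrix.mulVec_mulVec, hact j, Matrix.mulVec_smul]
    have e' := congrFun e i
    rw [coe_iotaA, Matrix.mulVec_diagonal, Pi.smul_apply, smul_eq_mul] at e'
    exact e'
  -- at the regular column both diagonal entries of `D` equal `β_{j₀}`
  obtain ⟨j₀, hj0, hj1⟩ := hreg
  rw [mul_apply_eq_mulVec _ _ f hP] at hj0 hj1
  have ha0 : ((a : Fin 2 → Fˣ) 0 : F) = β j₀ := mul_right_cancel₀ hj0 (key 0 j₀)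
  have ha1 : ((a : Fin 2 → Fˣ) 1 : F) = β j₀ := mul_right_cancel₀ hj1 (key 1 j₀)
  set z : F := β j₀ with hz
  have hzn : nrm σ z = 1 := hβ j₀
  -- every column of the invertible `γ P` is non-zero, so every `β_j` is `z`
  have hunit : IsUnit ((γ : Matrix (Fin 2) (Fin 2) F) * (P : Matrix (Fin 2) (Fin 2) F)).det := by
    rw [← Units.val_mul]
    exact (Matrix.isUnit_iff_isUnit_det _).1 (γ * P).isUnit
  have hβz : ∀ j, β j = z := by
    intro j
    by_contra hne
    apply hunit.ne_zero
    apply det_eq_zero_of_col_zero _ j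
    intro i
    rw [mul_apply_eq_mulVec _ _ f hP]
    have hai : ((a : Fin 2 → Fˣ) i : F) = z := by
      fin_cases i
      · exact ha0
      · exact ha1
    have := key i j
    rw [hai] at this
    by_contra hv
    exact hne (mul_right_cancel₀ hv this).symm
  refine ⟨z, hzn, ?_, ?_⟩
  · -- `D = z • 1`
    rw [coe_iotaA, Matrix.smul_one_eq_diagonal]
    congr 1
    funext i
    fin_cases i
    · exact ha0
    · exact ha1
  · -- `t = z • 1`: `t P = z • P`, then multiply by `P⁻¹`
    have htP : ((iotaB σ f b : GL (Fin 2) F) : Matrix (Fin 2) (Fin 2) F) * (P : Matrix (Fin 2) (Fin 2) F) =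
        z • (P : Matrix (Fin 2) (Fin 2) F) := by
      ext i j
      rw [mul_apply_eq_mulVec _ _ f hP, hact j, hβz j, Pi.smul_apply, smul_eq_mul, Matrix.smul_apply, smul_eq_mul]
      congr 1
      have := congrFun (hP j) i
      simpa [Matrix.col] using this.symm
    have hPP : (P : Matrix (Fin 2) (Fin 2) F) * ((P⁻¹ : GL (Fin 2) F) : Matrix (Fin 2) (Fin 2) F) = 1 :=
      Units.mul_inv P
    calc ((iotaB σ f b : GL (Fin 2) F) : Matrix (Fin 2) (Fin 2) F)
        = ((iotaB σ f b : GL (Fin 2) F) : Matrix (Fin 2) (Fin 2) F) *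
            ((P : Matrix (Fin 2) (Fin 2) F) * ((P⁻¹ : GL (Fin 2) F) : Matrix (Fin 2) (Fin 2) F)) := by
          rw [hPP, mul_one]
      _ = (((iotaB σ f b : GL (Fin 2) F) : Matrix (Fin 2) (Fin 2) F) * (P : Matrix (Fin 2) (Fin 2) F)) *
            ((P⁻¹ : GL (Fin 2) F) : Matrix (Fin 2) (Fin 2) F) := by rw [mul_assoc]
      _ = z • ((P : Matrix (Fin 2) (Fin 2) F) * ((P⁻¹ : GL (Fin 2) F) : Matrix (Fin 2) (Fin 2) F)) := by
          rw [htP, Matrix.smul_mul]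
      _ = z • (1 : Matrix (Fin 2) (Fin 2) F) := by rw [hPP]

/-! ## The consumer: `hmatch` from (C) on the centre -/

/-- **`hmatch` REDUCES TO (C) ON THE CENTRE**: for a regular dominant representative `loc γ₀` and characters `χA`, `ψB`
whose product is `1` on the norm-one scalars `(scalarA σ z, scalarB σ f z)`, the central match holds on the whole
stabiliser — x1's binder `hmatch` of `ConcreteLevelFactor.concrete_kappaData_b_fields` (l. 93) verbatim. -/
theorem hmatch_of_central {P : GL (Fin 2) F} (hP : ∀ j, (P : Matrix (Fin 2) (Fin 2) F).col j = f j)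
    {Orb : Type*} (loc : Orb → GL (Fin 2) F) (γ₀ : Orb) (hreg : Regular P (loc γ₀))
    {M : Type*} [Monoid M] (χA : torusA σ →* M) (ψB : torusB σ f →* M)
    (hC : ∀ (z : F) (hz : nrm σ z = 1), χA (scalarA σ z hz) * ψB (scalarB σ f z hz) = 1) :
    ∀ a b, (iotaA σ a)⁻¹ * loc γ₀ * iotaB σ f b = loc γ₀ → χA a * ψB b = 1 := by
  intro a b h
  obtain ⟨z, hz, hA, hB⟩ := central_of_stab σ f hP hreg a b h
  have ha : a = scalarA σ z hz := by
    apply iotaA_injective σ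
    apply Units.ext
    rw [hA, coe_iotaA_scalarA]
  have hb : b = scalarB σ f z hz := by
    apply iotaB_injective σ f
    apply Units.ext
    rw [hB, coe_iotaB_scalarB]
  rw [ha, hb]
  exact hC z hz

end Summit.Ventures.HodgeRepro2.T7SupportRegularStabilizer
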